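import Summits.QuantumFields.BalabanUV.T4Continuum.Support.NE7AccumulatedFrameDefectRemCornerSums
import Summits.QuantumFields.BalabanUV.T4Continuum.Support.NE7QbarIterL1DbarFree
import Summits.QuantumFields.BalabanUV.T4Continuum.Support.NE3ClassRadiusFamily
import HarnessLib

/-!
# Support | NE7 (gen 97, ROAD-G97 §5 «corner letters of the REM term», ℓ¹ FORM): A TREE CONTOUR AGAINST ITS OWN BLOCK IN ℓ¹ (`lnorm(Y; q, Γ_r) ≤ Σ_{v∈[0,L)^d}Σ_κ‖Y(q+v)κ‖`, the
# staircase of row NE3's `NE3FramePotBoundSharp` without Cauchy–Schwarz), AND THE PROP-4-REMAINDER TERM OF THE FRAME DEFECT SUMMED OVER THE TOP CORNERS: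
# `Σ_{z∈[0,N)^d} Σ_{m≤j} PA_m(ψ_m − QbarIter_m X)(z) ≤ 64C₁L²d(4L+1)^d·(Σ_{i<j}(L·L∕L^d)^i)·l2sq X` — no sup factor, N-free, via row NE3's ℓ¹ remainder tower (Γ1) AT EVERY LEVEL

Cell `pub-balaban`, rung (B)+1 sub-cell t4, lineage `b2b-balaban-t4-ne7-p1` (CRUX PROVER NE7 #1 = OWNER of row NE7), generation 97; memo `t4/b2b-balaban-t4-ne7-p1-g97/ROAD-G97.md` §§2, 4, 5
(ROAD-Γ′ S4, the κ-letter of the corner spikes: `(ε∕M²)·2pdev·c_dΣ_z‖f_z‖` needs the ℓ¹-over-corners letter of `f_z ≤ h_z + Σ_m PA_m(rem_m)(z)` in `honest × honest` form — rule (R2);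
the `h_z` half is `NE7AccumulatedFrameDefectCornerSums.sum_corners_norm_defect_le`; THIS FILE is the `rem` half).  Over gen 96's `NE7QbarIterL1DbarFree.dirL1_QbarIter_sub_le`
((Γ1)-ℓ¹: `dirL1_{[0,N′)^d}(QbarIter_{i+1} − Ad⁻¹Q_{i+1}) ≤ 64C₁L²d(4L+1)^d((L∕L^d)L)^i·l2sq X`) applied with the level `i+1 = m ≤ j` as the top of its own tower (all regime hypotheses
monotone in the level; `radSum` by `NE3ClassRadiusFamily.radSum_succ_eq`), this generation's `sum_periodBox_cornerBlocks_le`, and row NE3's staircase kit (`BlockAverageLoopFlux.upper`,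
`treeWord_upper_succ`, `BlockAverageDbarLinNorms.lnorm_seg_eq_sum`, `NE3FramePotBoundSharp.lnorm_append`).

WHAT ([folklore]; 0 def, 0 sorry).  §1 `sum_range_norm_le_line_l1` (a straight sub-segment of a block line against the block's line ℓ¹-mass), `lnorm_treeWord_upper_le_l1`,
**`lnorm_treeWord_boxVec_le_blockL1`** (`lnorm(Y; q, Γ_r) ≤ Σ_{v∈periodBox L}Σ_κ‖Y(q+v)κ‖`), `pathAvg_le_blockL1`.  §2 `radIter_nonneg`, `radSum_mono`.  §3 **`sum_corners_pathAvg_rem_le`**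
(one level `1 ≤ m ≤ j`: `Σ_z PA_m(rem_m)(z) ≤ 64C₁L²d(4L+1)^d·((L∕L^d)L)^{m−1}·l2sq X`), **`sum_corners_sum_pathAvg_rem_le`** (summed over the levels).
HONEST FRAMING (page 1): bookkeeping on OUR frame over landed kernel theorems; nothing of Bałaban's asserted; S2, S3, `hdecomp♭`, NE7 NOT proved; spine 0∕9; finite T⁴ rung (B)+1 — NOT
infinite volume, NOT mass gap, NOT `BetaPertH`, NOT Clay.  Continuum YM on T⁴ ⇐ BetaPertH ∧ nine spine estimates (0/9 proved); BetaPertH ⇐ (D1) ∧ (D4) ∧ CAP+tail; G-an2-4 gates asym,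
D1 and NE2/3/4.
-/

set_option autoImplicit false

open scoped BigOperators Matrix Matrix.Norms.L2Operator
open NormedSpace Finset

namespace Summit.QuantumFields.BalabanUV.T4Continuum.NE7AccumulatedFrameDefectRemCornerSumsL1

open Literature.MathematicalPhysics.QuantumFieldTheory.Balaban1983to89
open B7Prop1Explicit B7Prop2Explicit B7Prop3Flat MatrixLog
open B7Prop4GeneralLevels (logCovIter)
open T4AveragingDeficitWall (Ad IsUnitaryCfg SmallField dirL1)
open T4AveragingDeficitWallBoundary (IsPeriodicCfg periodBox mem_periodBox)
open AveragingDeficitPeriodicCounting (IsPeriodicDir)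
open AveragingDeficitTransport (lnorm lnorm_cons lnorm_nil norm_Ad_of_unitary)
open AveragingDeficitNearIdentity (lnorm_nonneg Ad_one)
open AveragingDeficitMultiLevelPrep (cavgIter LevelSmall radIter prop1Radius_nonneg)
open AveragingDeficitTwoLevelPrep (prop1Radius)
open AveragingDeficitMultiLevelBridge (cavgIter_eq_avgIter)
open ReplicationRightInverseBound (radSum)
open BlockAverageVaryHolo (nbRad)
open NE3CovariantLineSumsError (Csup)
open NE3TangentCovariantTower (QbarIter)
open NE3.QbarDictionary (adField)
open NE3CovariantLineSumsL2 (l2sq l2sq_nonneg)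
open ShellMeasureAverageProp4General (C1cov C1cov_pos)
open NE3FramePotBoundW (levelSmall_of_le)
open NE3ClassRadiusFamily (radSum_succ_eq)
open BlockAverageLoopFlux (upper upper_zero upper_apply_of_le upper_apply_of_lt treeWord_upper_succ)
open BlockAverageDbarLinNorms (lnorm_seg_eq_sum)
open NE3FramePotBoundSharp (lnorm_append)
open NE7QbarIterL1DbarFree (dirL1_QbarIter_sub_le)
open NE7AccumulatedFrameDefectCornerSums (sum_periodBox_cornerBlocks_le)
open NE7AccumulatedFrameDefectRemCornerSums (lnorm_sub_comm rem_zero_level)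

noncomputable section

variable {d : ℕ} {n : Type*} [Fintype n] [DecidableEq n]

/-! ## §1 A tree contour against its own block, in ℓ¹ -/

/-- **A STRAIGHT SUB-SEGMENT OF ONE LINE OF THE BLOCK AGAINST THE LINE's ℓ¹-MASS**: for an offset `u ∈ [0,L)^d` with `u_κ = 0` and `t ≤ L`,
`Σ_{i<t}‖Y(q + u + i•e_κ)κ‖ ≤ Σ_{v∈periodBox L}‖Y(q+v)κ‖` (the line's sites are distinct sites of the block). [folklore] -/
theorem sum_range_norm_le_line_l1 {L : ℕ} (Y : Site d → Fin d → Matrix n n ℂ) (q u : Site d) (κ : Fin d)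
    (hu : ∀ j, 0 ≤ u j ∧ u j < L) (huκ : u κ = 0) {t : ℕ} (ht : t ≤ L) :
    ∑ i ∈ range t, ‖Y (q + u + (i : ℤ) • e κ) κ‖ ≤ ∑ v ∈ periodBox (d := d) L, ‖Y (q + v) κ‖ := by
  set f : ℕ → ℝ := fun i => ‖Y (q + u + (i : ℤ) • e κ) κ‖ with hf
  have hf0 : ∀ i, 0 ≤ f i := fun i => norm_nonneg _
  have h1 : ∑ i ∈ range t, f i ≤ ∑ i ∈ range L, f i :=
    Finset.sum_le_sum_of_subset_of_nonneg (Finset.range_mono ht) fun i _ _ => hf0 i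
  set φ : ℕ → Site d := fun i => u + (i : ℤ) • e κ with hφ
  have hφκ : ∀ i : ℕ, φ i κ = (i : ℤ) := fun i => by
    simp only [hφ, Pi.add_apply, Pi.smul_apply, e_apply, if_true, smul_eq_mul, mul_one, huκ, zero_add]
  have hφj : ∀ (i : ℕ) (j : Fin d), j ≠ κ → φ i j = u j := fun i j hj => by
    simp only [hφ, Pi.add_apply, Pi.smul_apply, e_apply, if_neg hj, smul_eq_mul, mul_zero, add_zero]
  have hinj : Set.InjOn φ ↑(range L) := by
    intro i _ i' _ h
    have hκ := congr_fun h κ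
    rw [hφκ, hφκ] at hκ
    exact_mod_cast hκ
  have himg : (range L).image φ ⊆ periodBox (d := d) L := by
    intro v hv
    obtain ⟨i, hi, rfl⟩ := Finset.mem_image.mp hv
    have hiL : i < L := Finset.mem_range.mp hi
    rw [mem_periodBox]
    intro j
    by_cases hj : j = κ
    · subst hj; rw [hφκ]; exact ⟨by positivity, by exact_mod_cast hiL⟩
    · rw [hφj i j hj]; exact hu j
  have h3 : ∑ i ∈ range L, f i ≤ ∑ v ∈ periodBox (d := d) L, ‖Y (q + v) κ‖ := by
    have e1 : ∑ i ∈ range L, f i = ∑ v ∈ (range L).image φ, ‖Y (q + v) κ‖ := by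
      rw [Finset.sum_image hinj]
      refine Finset.sum_congr rfl fun i _ => ?_
      simp only [hf, hφ, add_assoc]
    rw [e1]
    exact Finset.sum_le_sum_of_subset_of_nonneg himg fun v _ _ => norm_nonneg _
  exact h1.trans h3

/-- **THE STAIRCASE IN ℓ¹** (descending induction on the directions, as `NE3FramePotBoundSharp.lnorm_treeWord_upper_le`): the tail `Γ_{q, q + upper (d−i) r}` of the tree contour costs at
most `Σ_{κ ≥ d−i} Σ_{v∈periodBox L}‖Y(q+v)κ‖`. [folklore] -/
theorem lnorm_treeWord_upper_le_l1 {L : ℕ} (hL : 1 ≤ L) (Y : Site d → Fin d → Matrix n n ℂ) (q : Site d) (r : Fin d → Fin L) :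
    ∀ i : ℕ, i ≤ d → lnorm Y q (treeWord (upper (d - i) (boxVec L r)))
      ≤ ∑ κ : Fin d, if d - i ≤ (κ : ℕ) then ∑ v ∈ periodBox (d := d) L, ‖Y (q + v) κ‖ else 0
  | 0, _ => by
      have h0 : upper d (boxVec L r) = (0 : Site d) := funext fun j => upper_apply_of_lt _ j.2
      rw [Nat.sub_zero, h0, treeWord_zero, AveragingDeficitTransport.lnorm_nil]
      exact Finset.sum_nonneg fun κ _ => by split_ifs <;> first | exact Finset.sum_nonneg fun v _ => norm_nonneg _ | exact le_rfl
  | i + 1, hi => by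
      obtain ⟨m, hm⟩ : ∃ m : ℕ, m = d - (i + 1) := ⟨_, rfl⟩
      have hmd : m < d := by omega
      have hm1 : m + 1 = d - i := by omega
      have ih := lnorm_treeWord_upper_le_l1 hL Y q r i (by omega)
      rw [← hm1] at ih
      rw [← hm]
      set μ : Fin d := ⟨m, hmd⟩ with hμ
      have hμv : (μ : ℕ) = m := rfl
      have hsplit := treeWord_upper_succ μ (boxVec L r)
      rw [hμv] at hsplit
      rw [hsplit, lnorm_append, disp_treeWord]
      -- the segment term
      have hseg : lnorm Y (q + upper (m + 1) (boxVec L r)) (seg μ (boxVec L r μ)) ≤ ∑ v ∈ periodBox (d := d) L, ‖Y (q + v) μ‖ := by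
        have hv : boxVec L r μ = ((r μ : ℕ) : ℤ) := rfl
        rw [hv, lnorm_seg_eq_sum]
        refine sum_range_norm_le_line_l1 Y q _ μ (fun j => ?_) ?_ (r μ).2.le
        · by_cases hj : m + 1 ≤ (j : ℕ)
          · rw [upper_apply_of_le _ hj]
            exact ⟨by simp [boxVec], by simp [boxVec]⟩
          · rw [upper_apply_of_lt _ (by omega)]
            exact ⟨le_rfl, by exact_mod_cast hL⟩
        · exact upper_apply_of_lt _ (by rw [hμv]; omega)
      -- the right-hand side splits off the term `κ = μ`
      have hrhs : (∑ κ : Fin d, if m ≤ (κ : ℕ) then ∑ v ∈ periodBox (d := d) L, ‖Y (q + v) κ‖ else 0)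
          = (∑ v ∈ periodBox (d := d) L, ‖Y (q + v) μ‖)
            + ∑ κ : Fin d, if m + 1 ≤ (κ : ℕ) then ∑ v ∈ periodBox (d := d) L, ‖Y (q + v) κ‖ else 0 := by
        have hpt : ∀ κ : Fin d,
            (if m ≤ (κ : ℕ) then ∑ v ∈ periodBox (d := d) L, ‖Y (q + v) κ‖ else 0)
              = (if κ = μ then ∑ v ∈ periodBox (d := d) L, ‖Y (q + v) κ‖ else 0)
                + (if m + 1 ≤ (κ : ℕ) then ∑ v ∈ periodBox (d := d) L, ‖Y (q + v) κ‖ else 0) := by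
          intro κ
          by_cases hκ : κ = μ
          · subst hκ
            rw [if_pos (le_of_eq hμv.symm), if_pos rfl, if_neg (by rw [hμv]; omega), add_zero]
          · have hne : (κ : ℕ) ≠ m := fun h => hκ (Fin.ext (by rw [h, hμv]))
            rw [if_neg hκ, zero_add]
            by_cases hle : m + 1 ≤ (κ : ℕ)
            · rw [if_pos hle, if_pos (by omega)]
            · rw [if_neg hle, if_neg (by omega)]
        rw [Finset.sum_congr rfl fun κ _ => hpt κ, Finset.sum_add_distrib, Finset.sum_ite_eq' univ μ, if_pos (Finset.mem_univ _)]
      rw [hrhs]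
      linarith [ih, hseg]

/-- **THE WHOLE TREE CONTOUR AGAINST THE BLOCK, IN ℓ¹**: `lnorm Y q (treeWord (boxVec L r)) ≤ Σ_{v∈periodBox L} Σ_κ ‖Y (q+v) κ‖` for EVERY `r` (`1 ≤ L`). [folklore] -/
theorem lnorm_treeWord_boxVec_le_blockL1 {L : ℕ} (hL : 1 ≤ L) (Y : Site d → Fin d → Matrix n n ℂ) (q : Site d) (r : Fin d → Fin L) :
    lnorm Y q (treeWord (boxVec L r)) ≤ ∑ v ∈ periodBox (d := d) L, ∑ κ : Fin d, ‖Y (q + v) κ‖ := by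
  have h := lnorm_treeWord_upper_le_l1 hL Y q r d le_rfl
  rw [Nat.sub_self, upper_zero] at h
  refine h.trans (le_of_eq ?_)
  rw [Finset.sum_comm]
  exact Finset.sum_congr rfl fun κ _ => if_pos (Nat.zero_le _)

/-- **THE PATH-AVERAGE AGAINST THE BLOCK ℓ¹-MASS**: `L^{−d}Σ_r lnorm(Y; q, Γ_r) ≤ Σ_{v∈periodBox L}Σ_κ‖Y(q+v)κ‖` (`1 ≤ L`). [folklore] -/
theorem pathAvg_le_blockL1 {L : ℕ} (hL : 1 ≤ L) (Y : Site d → Fin d → Matrix n n ℂ) (q : Site d) :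
    ((L : ℝ) ^ d)⁻¹ * ∑ r : Fin d → Fin L, lnorm Y q (treeWord (boxVec L r)) ≤ ∑ v ∈ periodBox (d := d) L, ∑ κ : Fin d, ‖Y (q + v) κ‖ := by
  have hcard : (Finset.univ : Finset (Fin d → Fin L)).card = L ^ d := by simp
  have hLd : (0 : ℝ) < (L : ℝ) ^ d := pow_pos (by exact_mod_cast (by omega : 0 < L)) d
  calc ((L : ℝ) ^ d)⁻¹ * ∑ r : Fin d → Fin L, lnorm Y q (treeWord (boxVec L r))
      ≤ ((L : ℝ) ^ d)⁻¹ * ∑ _r : Fin d → Fin L, ∑ v ∈ periodBox (d := d) L, ∑ κ : Fin d, ‖Y (q + v) κ‖ :=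
        mul_le_mul_of_nonneg_left (Finset.sum_le_sum fun r _ => lnorm_treeWord_boxVec_le_blockL1 hL Y q r) (by positivity)
    _ = ∑ v ∈ periodBox (d := d) L, ∑ κ : Fin d, ‖Y (q + v) κ‖ := by
        rw [Finset.sum_const, hcard, nsmul_eq_mul]; push_cast; field_simp

/-! ## §2 Monotonicity of the class radius sum in the level -/

omit [Fintype n] [DecidableEq n] in
/-- The iterated class radius is non-negative. [folklore] -/
theorem radIter_nonneg {L : ℕ} : ∀ (i : ℕ) {x : ℝ}, 0 ≤ x → 0 ≤ radIter d L i x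
  | 0, _, hx => hx
  | i + 1, _, hx => radIter_nonneg i (prop1Radius_nonneg (d := d) (L := L) hx)

omit [Fintype n] [DecidableEq n] in
/-- **`radSum` IS MONOTONE IN THE LEVEL**: `radSum d L i x ≤ radSum d L j x` for `i ≤ j`, `0 ≤ x`. [folklore] -/
theorem radSum_mono (L : ℕ) {i j : ℕ} (hij : i ≤ j) {x : ℝ} (hx : 0 ≤ x) : radSum d L i x ≤ radSum d L j x := by
  induction j, hij using Nat.le_induction with
  | base => exact le_rfl
  | succ j _ ih =>
      rw [radSum_succ_eq (d := d) L j x]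
      have := radIter_nonneg (d := d) (L := L) (j + 1) hx
      linarith

/-! ## §3 The remainder term of the frame defect, summed over the top corners (ℓ¹) -/

/-- **CORNER SUM OF `PA(rem_m)` AGAINST ROW NE3's ℓ¹ REMAINDER TOWER AT LEVEL `m`**: in the tower class at `W` at the top level `j+1` (hypotheses of
`NE7QbarIterL1DbarFree.dirL1_QbarIter_sub_le`), for every `1 ≤ m ≤ j`, `Σ_{z∈[0,N)^d} L^{−d}Σ_r lnorm(rem_m; L^{j+1−m}•z, Γ_r) ≤ 64C₁L²d(4L+1)^d·((L∕L^d)·L)^{m−1}·l2sq_{[0,N·L^{j+1})^d} X`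
(ℓ¹ staircase on each corner block, disjointness of the corner blocks in `[0, N·L^{j+1−m})^d`, (Γ1)-ℓ¹ with the level `m` as the top of its own tower). [folklore] -/
theorem sum_corners_pathAvg_rem_le [Nonempty n] {L N : ℕ} (hL : 2 ≤ L) (hN : 1 ≤ N) (j : ℕ)
    {W : Site d → Fin d → (Matrix n n ℂ)ˣ} {x : ℝ} (hWu : IsUnitaryCfg W) (hWP : IsPeriodicCfg W ((N * L ^ (j + 1) : ℕ) : ℤ))
    (hx : 0 ≤ x) (hsm : LevelSmall d L j x) (hWx : SmallField W x)
    {α₀ b : ℝ} (hα : 0 < α₀) (hα3 : C0 d * (2 * α₀) ≤ 1 / 3) (hα4 : 4 * (2 * α₀) ≤ c2' d L)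
    (h52 : pdev W < α₀ * (((L : ℝ) ^ (j + 1))⁻¹) ^ 2) (hb : 0 ≤ b)
    {X : Site d → Fin d → Matrix n n ℂ} (hX : ∀ (y : Site d) (κ : Fin d), ‖X y κ‖ ≤ b) (hXP : IsPeriodicDir X ((N * L ^ (j + 1) : ℕ) : ℤ))
    (hsmall : Real.exp (4 * (800 * ((d : ℝ) + 1) ^ 2 * ((d : ℝ) + 4)) * α₀)
      * (1 + 8 * (131072 * ((d : ℝ) + 1) ^ 2) * ((L : ℝ) ^ (j + 1) * b)) ≤ 2)
    (hc₃ : 4 * ((L : ℝ) ^ (j + 1) * b) ≤ c3 d L)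
    (hK : 16 * (C1cov d * (L : ℝ) ^ 2 * Real.sqrt (d * (2 * (2 * L) + 1) ^ d)) * (L : ℝ) ^ (j + 1) * b ≤ Real.sqrt ((L : ℝ) ^ 2 / (L : ℝ) ^ d))
    (hS1 : (16 * (d + 1) * (d + 4) * (L : ℝ) ^ 2 * Csup d L * (d * (2 * nbRad d L + 1) ^ d)) * radSum d L j x ≤ ((L : ℝ) / (L : ℝ) ^ d) / 2)
    {m : ℕ} (hm1 : 1 ≤ m) (hm : m ≤ j) :
    ∑ z ∈ periodBox (d := d) N, ((L : ℝ) ^ d)⁻¹ * ∑ r : Fin d → Fin L,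
        lnorm (fun x' μ => Ad (avgIter L W m x' μ)⁻¹ (logCovIter L W (adField W X) m x' μ) - QbarIter L m W X x' μ)
          (((L : ℤ) ^ (j + 1 - m)) • z) (treeWord (boxVec L r))
      ≤ 64 * (C1cov d * (L : ℝ) ^ 2 * (d * (2 * (2 * (L : ℝ)) + 1) ^ d)) * (((L : ℝ) / (L : ℝ) ^ d) * L) ^ (m - 1)
          * l2sq (periodBox (d := d) (N * L ^ (j + 1))) X := by
  letI : CStarAlgebra (Matrix n n ℂ) := {}
  have hL1 : 1 ≤ L := by omega
  have hL1R : (1 : ℝ) ≤ L := by exact_mod_cast hL1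
  obtain ⟨i, rfl⟩ : ∃ i, m = i + 1 := ⟨m - 1, by omega⟩
  have hij : i ≤ j := by omega
  set P : ℕ := L ^ (j + 1 - (i + 1)) with hPdef
  set N' : ℕ := N * P with hN'def
  have hP1 : 1 ≤ P := Nat.one_le_pow _ L (by omega)
  have hN'1 : 1 ≤ N' := Nat.one_le_iff_ne_zero.mpr (Nat.mul_ne_zero (by omega) (by omega))
  have hNN : N' * L ^ (i + 1) = N * L ^ (j + 1) := by
    rw [hN'def, hPdef, mul_assoc, ← pow_add]; congr 2; omega
  -- the regime hypotheses at the lower level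
  have hpow_le : (L : ℝ) ^ (i + 1) ≤ (L : ℝ) ^ (j + 1) := pow_le_pow_right₀ hL1R (by omega)
  have hlev_le : (L : ℝ) ^ (i + 1) * b ≤ (L : ℝ) ^ (j + 1) * b := mul_le_mul_of_nonneg_right hpow_le hb
  have hWP' : IsPeriodicCfg W ((N' * L ^ (i + 1) : ℕ) : ℤ) := by rw [hNN]; exact hWP
  have hXP' : IsPeriodicDir X ((N' * L ^ (i + 1) : ℕ) : ℤ) := by rw [hNN]; exact hXP
  have hsm' : LevelSmall d L i x := levelSmall_of_le hij hsm
  have h52' : pdev W < α₀ * (((L : ℝ) ^ (i + 1))⁻¹) ^ 2 := by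
    refine lt_of_lt_of_le h52 (mul_le_mul_of_nonneg_left ?_ hα.le)
    have h1 : ((L : ℝ) ^ (j + 1))⁻¹ ≤ ((L : ℝ) ^ (i + 1))⁻¹ := inv_anti₀ (by positivity) hpow_le
    exact pow_le_pow_left₀ (by positivity) h1 2
  have hsmall' : Real.exp (4 * (800 * ((d : ℝ) + 1) ^ 2 * ((d : ℝ) + 4)) * α₀)
      * (1 + 8 * (131072 * ((d : ℝ) + 1) ^ 2) * ((L : ℝ) ^ (i + 1) * b)) ≤ 2 := by
    refine le_trans (mul_le_mul_of_nonneg_left ?_ (Real.exp_pos _).le) hsmall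
    nlinarith [hlev_le]
  have hc₃' : 4 * ((L : ℝ) ^ (i + 1) * b) ≤ c3 d L := by nlinarith [hlev_le]
  have hK' : 16 * (C1cov d * (L : ℝ) ^ 2 * Real.sqrt (d * (2 * (2 * L) + 1) ^ d)) * (L : ℝ) ^ (i + 1) * b ≤ Real.sqrt ((L : ℝ) ^ 2 / (L : ℝ) ^ d) := by
    have hK0 : 0 ≤ 16 * (C1cov d * (L : ℝ) ^ 2 * Real.sqrt (d * (2 * (2 * L) + 1) ^ d)) := by have := C1cov_pos d; positivity
    refine le_trans ?_ hK
    have := mul_le_mul_of_nonneg_left hlev_le hK0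
    nlinarith
  have hS1' : (16 * (d + 1) * (d + 4) * (L : ℝ) ^ 2 * Csup d L * (d * (2 * nbRad d L + 1) ^ d)) * radSum d L i x ≤ ((L : ℝ) / (L : ℝ) ^ d) / 2 := by
    refine le_trans (mul_le_mul_of_nonneg_left (radSum_mono (d := d) L hij hx) ?_) hS1
    have := NE3CovariantLineSumsError.Csup_nonneg d L; positivity
  -- (Γ1)-ℓ¹ at level `i+1` over `periodBox N'`
  have hΓ := dirL1_QbarIter_sub_le hL hN'1 i hWu hWP' hx hsm' hWx hα hα3 hα4 h52' hb hX hXP' hsmall' hc₃' hK' hS1'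
  rw [hNN] at hΓ
  set R : Site d → Fin d → Matrix n n ℂ := fun z κ => QbarIter L (i + 1) W X z κ
      - Ad ((cavgIter L (i + 1) W) z κ)⁻¹ (logCovIter L W (adField W X) (i + 1) z κ) with hR
  set rem : Site d → Fin d → Matrix n n ℂ := fun x' μ => Ad (avgIter L W (i + 1) x' μ)⁻¹ (logCovIter L W (adField W X) (i + 1) x' μ) - QbarIter L (i + 1) W X x' μ
    with hrem
  have hnormR : ∀ (y : Site d) (κ : Fin d), ‖rem y κ‖ = ‖R y κ‖ := by
    intro y κ; simp only [hrem, hR]; rw [cavgIter_eq_avgIter, norm_sub_rev]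
  -- ℓ¹ staircase on each corner block, then disjointness of the corner blocks
  have hLP : L ≤ P := by
    rw [hPdef]
    calc L = L ^ 1 := (pow_one L).symm
      _ ≤ L ^ (j + 1 - (i + 1)) := Nat.pow_le_pow_right (by omega) (by omega)
  have hPz : ∀ z : Site d, (((L : ℤ) ^ (j + 1 - (i + 1))) • z : Site d) = (P : ℤ) • z := fun z => by rw [hPdef]; push_cast; rfl
  have hblock : ∀ z : Site d, ((L : ℝ) ^ d)⁻¹ * ∑ r : Fin d → Fin L, lnorm rem (((L : ℤ) ^ (j + 1 - (i + 1))) • z) (treeWord (boxVec L r))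
      ≤ ∑ v ∈ periodBox (d := d) L, ∑ κ : Fin d, ‖R (((L : ℤ) ^ (j + 1 - (i + 1))) • z + v) κ‖ := by
    intro z
    refine (pathAvg_le_blockL1 hL1 rem _).trans (le_of_eq ?_)
    exact Finset.sum_congr rfl fun v _ => Finset.sum_congr rfl fun κ _ => by rw [hnormR]
  have htile : ∑ z ∈ periodBox (d := d) N, ∑ v ∈ periodBox (d := d) L, ∑ κ : Fin d, ‖R (((L : ℤ) ^ (j + 1 - (i + 1))) • z + v) κ‖
      ≤ dirL1 R (periodBox (d := d) N') := by
    have h := sum_periodBox_cornerBlocks_le (d := d) hL1 hLP N (g := fun w => ∑ κ : Fin d, ‖R w κ‖)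
      (fun w => Finset.sum_nonneg fun κ _ => norm_nonneg _)
    have e : ∑ z ∈ periodBox (d := d) N, ∑ v ∈ periodBox (d := d) L, ∑ κ : Fin d, ‖R (((L : ℤ) ^ (j + 1 - (i + 1))) • z + v) κ‖
        = ∑ z ∈ periodBox (d := d) N, ∑ v ∈ periodBox (d := d) L, ∑ κ : Fin d, ‖R ((P : ℤ) • z + v) κ‖ :=
      Finset.sum_congr rfl fun z _ => Finset.sum_congr rfl fun v _ => by rw [hPz]
    rw [e]
    refine h.trans (le_of_eq ?_)
    rw [hN'def, Nat.mul_comm N P]; rfl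
  calc ∑ z ∈ periodBox (d := d) N, ((L : ℝ) ^ d)⁻¹ * ∑ r : Fin d → Fin L, lnorm rem (((L : ℤ) ^ (j + 1 - (i + 1))) • z) (treeWord (boxVec L r))
      ≤ ∑ z ∈ periodBox (d := d) N, ∑ v ∈ periodBox (d := d) L, ∑ κ : Fin d, ‖R (((L : ℤ) ^ (j + 1 - (i + 1))) • z + v) κ‖ := Finset.sum_le_sum fun z _ => hblock z
    _ ≤ dirL1 R (periodBox (d := d) N') := htile
    _ ≤ 64 * (C1cov d * (L : ℝ) ^ 2 * (d * (2 * (2 * (L : ℝ)) + 1) ^ d)) * (((L : ℝ) / (L : ℝ) ^ d) * L) ^ (i + 1 - 1) * l2sq (periodBox (d := d) (N * L ^ (j + 1))) X := hΓ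

/-- **THE REMAINDER TERM OF THE FRAME DEFECT SUMMED OVER THE TOP CORNERS (ℓ¹)** (same regime): `Σ_{z∈[0,N)^d} Σ_{m≤j} PA_m(rem_m)(z) ≤ 64C₁L²d(4L+1)^d·(Σ_{i<j}((L∕L^d)L)^i)·l2sq X` —
the level-0 term vanishes; in d ≥ 3 the level sum is `≤ 2` (`(L∕L^d)L = L^{2−d} ≤ 1∕2`); no sup factor, N-free (memo §2 (R2): `honest × honest`). [folklore] -/
theorem sum_corners_sum_pathAvg_rem_le [Nonempty n] {L N : ℕ} (hL : 2 ≤ L) (hN : 1 ≤ N) (j : ℕ)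
    {W : Site d → Fin d → (Matrix n n ℂ)ˣ} {x : ℝ} (hWu : IsUnitaryCfg W) (hWP : IsPeriodicCfg W ((N * L ^ (j + 1) : ℕ) : ℤ))
    (hx : 0 ≤ x) (hsm : LevelSmall d L j x) (hWx : SmallField W x)
    {α₀ b : ℝ} (hα : 0 < α₀) (hα3 : C0 d * (2 * α₀) ≤ 1 / 3) (hα4 : 4 * (2 * α₀) ≤ c2' d L)
    (h52 : pdev W < α₀ * (((L : ℝ) ^ (j + 1))⁻¹) ^ 2) (hb : 0 ≤ b)
    {X : Site d → Fin d → Matrix n n ℂ} (hX : ∀ (y : Site d) (κ : Fin d), ‖X y κ‖ ≤ b) (hXP : IsPeriodicDir X ((N * L ^ (j + 1) : ℕ) : ℤ))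
    (hsmall : Real.exp (4 * (800 * ((d : ℝ) + 1) ^ 2 * ((d : ℝ) + 4)) * α₀)
      * (1 + 8 * (131072 * ((d : ℝ) + 1) ^ 2) * ((L : ℝ) ^ (j + 1) * b)) ≤ 2)
    (hc₃ : 4 * ((L : ℝ) ^ (j + 1) * b) ≤ c3 d L)
    (hK : 16 * (C1cov d * (L : ℝ) ^ 2 * Real.sqrt (d * (2 * (2 * L) + 1) ^ d)) * (L : ℝ) ^ (j + 1) * b ≤ Real.sqrt ((L : ℝ) ^ 2 / (L : ℝ) ^ d))
    (hS1 : (16 * (d + 1) * (d + 4) * (L : ℝ) ^ 2 * Csup d L * (d * (2 * nbRad d L + 1) ^ d)) * radSum d L j x ≤ ((L : ℝ) / (L : ℝ) ^ d) / 2) :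
    ∑ z ∈ periodBox (d := d) N, ∑ m ∈ range (j + 1), ((L : ℝ) ^ d)⁻¹ * ∑ r : Fin d → Fin L,
        lnorm (fun x' μ => Ad (avgIter L W m x' μ)⁻¹ (logCovIter L W (adField W X) m x' μ) - QbarIter L m W X x' μ)
          (((L : ℤ) ^ (j + 1 - m)) • z) (treeWord (boxVec L r))
      ≤ 64 * (C1cov d * (L : ℝ) ^ 2 * (d * (2 * (2 * (L : ℝ)) + 1) ^ d)) * (∑ i ∈ range j, (((L : ℝ) / (L : ℝ) ^ d) * L) ^ i)
          * l2sq (periodBox (d := d) (N * L ^ (j + 1))) X := by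
  letI : CStarAlgebra (Matrix n n ℂ) := {}
  set k : ℕ := j + 1 with hk
  set PA : ℕ → Site d → ℝ := fun m z => ((L : ℝ) ^ d)⁻¹ * ∑ r : Fin d → Fin L,
      lnorm (fun x' μ => Ad (avgIter L W m x' μ)⁻¹ (logCovIter L W (adField W X) m x' μ) - QbarIter L m W X x' μ)
        (((L : ℤ) ^ (k - m)) • z) (treeWord (boxVec L r)) with hPA
  set A : ℝ := 64 * (C1cov d * (L : ℝ) ^ 2 * (d * (2 * (2 * (L : ℝ)) + 1) ^ d)) with hA
  set σ : ℝ := ((L : ℝ) / (L : ℝ) ^ d) * L with hσ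
  set E : ℝ := l2sq (periodBox (d := d) (N * L ^ k)) X with hE
  have hE0 : 0 ≤ E := l2sq_nonneg _ _
  have hσ0 : 0 ≤ σ := by positivity
  have hA0 : 0 ≤ A := by have := C1cov_pos d; positivity
  show ∑ z ∈ periodBox (d := d) N, ∑ m ∈ range k, PA m z ≤ A * (∑ i ∈ range j, σ ^ i) * E
  -- the level-0 functional vanishes
  have hPA0z : ∀ z, PA 0 z = 0 := by
    intro z; simp only [hPA]
    have : ∀ r : Fin d → Fin L, lnorm (fun x' μ => Ad (avgIter L W 0 x' μ)⁻¹ (logCovIter L W (adField W X) 0 x' μ) - QbarIter L 0 W X x' μ)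
        (((L : ℤ) ^ (k - 0)) • z) (treeWord (boxVec L r)) = 0 := by
      intro r
      have e : (fun x' μ => Ad (avgIter L W 0 x' μ)⁻¹ (logCovIter L W (adField W X) 0 x' μ) - QbarIter L 0 W X x' μ) = fun _ _ => (0 : Matrix n n ℂ) := by
        funext x' μ; exact rem_zero_level L W X x' μ
      rw [e]
      clear e
      generalize (((L : ℤ) ^ (k - 0)) • z : Site d) = y
      induction treeWord (boxVec L r) generalizing y with
      | nil => exact lnorm_nil _ _
      | cons l w ih => rw [lnorm_cons, ih, norm_zero, zero_add]
    rw [Finset.sum_congr rfl fun r _ => this r, Finset.sum_const_zero, mul_zero]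
  -- level by level (§3, first theorem), the level `0` contributing nothing
  have hlev : ∀ m ∈ range k, ∑ z ∈ periodBox (d := d) N, PA m z ≤ if m = 0 then 0 else A * σ ^ (m - 1) * E := by
    intro m hm
    have hmk := Finset.mem_range.mp hm
    by_cases hm0 : m = 0
    · subst hm0
      rw [if_pos rfl]
      exact le_of_eq (Finset.sum_eq_zero fun z _ => hPA0z z)
    · rw [if_neg hm0]
      have h := sum_corners_pathAvg_rem_le hL hN j hWu hWP hx hsm hWx hα hα3 hα4 h52 hb hX hXP hsmall hc₃ hK hS1 (m := m) (by omega) (by omega)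
      simp only [hPA, hA, hσ, hE, hk] at h ⊢
      exact h
  have hsumlev : ∑ m ∈ range k, (if m = 0 then (0 : ℝ) else A * σ ^ (m - 1) * E) = A * (∑ i ∈ range j, σ ^ i) * E := by
    rw [hk, Finset.sum_range_succ']
    simp only [Nat.succ_ne_zero, if_false, if_true, Nat.add_sub_cancel, add_zero]
    rw [Finset.mul_sum, Finset.sum_mul]
  calc ∑ z ∈ periodBox (d := d) N, ∑ m ∈ range k, PA m z
      = ∑ m ∈ range k, ∑ z ∈ periodBox (d := d) N, PA m z := Finset.sum_comm
    _ ≤ ∑ m ∈ range k, (if m = 0 then (0 : ℝ) else A * σ ^ (m - 1) * E) := Finset.sum_le_sum hlev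
    _ = A * (∑ i ∈ range j, σ ^ i) * E := hsumlev

end

end Summit.QuantumFields.BalabanUV.T4Continuum.NE7AccumulatedFrameDefectRemCornerSumsL1
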